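import Mathlib
import HarnessLib

/-!
# The fluctuation-theorem uncertainty relation (Hasegawa–Van Vu 2019), as a named fact

Topic `Literature/Probability/Entropy`. This file STATES (D-0014; no proof here) the
*fluctuation theorem uncertainty relation* (FTUR) of Hasegawa and Van Vu, Phys. Rev. Lett. 123,
110602 (2019), arXiv:1902.06376, in measure-theoretic form.

**The printed result** (read with `lit read arxiv:1902.06376`, pp. 3–4 of the arXiv text). Setting:
a "total entropy production" `σ(Γ)` and an observable `φ(Γ)` of the trajectory `Γ`, both
anti-symmetric under the time reversal `Γ ↦ Γ†` — "(1) `σ(Γ†) = −σ(Γ)`", "(2) `φ(Γ†) = −φ(Γ)` … As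
long as Eq. (2) holds, `φ(Γ)` can be an arbitrary function of `Γ`" — and obeying "the following
strong detailed fluctuation theorem (3) `P(σ, φ) = e^σ P(−σ, −φ)`". "We now derive the FTUR solely
from Eq. (3)": with `Q(σ, φ) := (1 + e^{−σ}) P(σ, φ)` on `σ ≥ 0`, `⟨φ⟩ = ⟨φ tanh(σ/2)⟩_Q`,
`⟨σ⟩ = ⟨σ tanh(σ/2)⟩_Q`, `⟨φ²⟩ = ⟨φ²⟩_Q`, Cauchy–Schwarz and
`⟨tanh²(σ/2)⟩_Q ≤ ⟨tanh[(σ/2)tanh(σ/2)]⟩_Q ≤ tanh(⟨σ⟩/2)` (Jensen), "we obtain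
`⟨φ²⟩/⟨φ⟩² ≥ tanh(⟨σ⟩/2)^{−1}`, which yields (10) `Var[φ]/⟨φ⟩² ≥ 2/(e^{⟨σ⟩} − 1)`. Here
`Var[φ] ≡ ⟨φ²⟩ − ⟨φ⟩²` … We refer to Eq. (10) as the FTUR, which is the main result of the present
Letter." "Equation (10) is valid for arbitrary dynamics as long as the fluctuation theorem of Eq. (3)
holds."

**Rendering.** The only input of the printed derivation is the joint detailed fluctuation theorem
(3) for the pair `(σ, φ)`. Measure-theoretically: a probability measure `P` on `Ω` (path space), a
measurable involution `ι : Ω → Ω` (time reversal, possibly composed with momentum flip) with `P`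
and `ι_* P` mutually absolutely continuous, `σ := log dP/d(ι_* P)` (Mathlib `MeasureTheory.llr P
(P.map ι)`), and `φ` with `φ ∘ ι = −φ`. Then `σ ∘ ι = −σ` a.e. and, for every bounded measurable
`g`, `∫ g(σ, φ) dP = ∫ e^{σ} g(σ, φ) d(ι_*P) = ∫ e^{−σ} g(−σ, −φ) dP`, which is (3) in integrated
form; `⟨σ⟩ = ∫ llr P (ι_*P) dP = KL(P ‖ ι_*P) ≥ 0`. The conclusion is stated division-free,
`⟨φ⟩² ≤ ½ · Var[φ] · (e^{⟨σ⟩} − 1)` (equivalent to (10) when `⟨φ⟩ ≠ 0`; when `⟨σ⟩ = 0` both sides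
vanish since then `P = ι_*P` forces `⟨φ⟩ = 0`), under the integrability the printed manipulations
use (`φ ∈ L²(P)`, `σ ∈ L¹(P)`); `Var[φ]` is Mathlib's `ProbabilityTheory.variance φ P`.

**Use.** Grounds `Summit.AtomisticToContinuum.FouriersLaw.Theses.BondHeatUncertainty.LinearResponseFTUR`
(route `AtomisticToContinuum/BondHeatUncertainty`, the engine (★)): there `P` = stationary path
measure of the two-temperature chain on `[0, t]`, `ι` = time reversal ∘ momentum flip, `φ = Q_t^{(b)}`
the heat through bond `b`, `⟨σ⟩ = σ_δ t + KL(μ_δ ‖ Θ_*μ_δ)`; the item is this inequality divided by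
`2δ²` in the limit `δ → 0` (plus the model-specific identification of `σ`, which is NOT part of this
fact).

## References

* [HasegawaVanVu2019] Y. Hasegawa, T. Van Vu, *Fluctuation theorem uncertainty relation*, Phys.
  Rev. Lett. 123 (2019) 110602; arXiv:1902.06376, Eqs. (1)–(3), (10).
* [VanVuHasegawa2019] T. Van Vu, Y. Hasegawa, *Uncertainty relations for underdamped Langevin
  dynamics*, Phys. Rev. E 100 (2019) 032130; arXiv:1901.05715 (the initial-state / momentum-flip
  term).
-/

namespace Literature.Probability.Entropy

open MeasureTheory ProbabilityTheory

/-- **Hasegawa–Van Vu 2019, fluctuation theorem uncertainty relation (PRL 123, 110602, Eq. (10)).**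
"the following strong detailed fluctuation theorem (3) `P(σ, φ) = e^σ P(−σ, −φ)` … we obtain …
(10) `Var[φ]/⟨φ⟩² ≥ 2/(e^{⟨σ⟩} − 1)` … valid for arbitrary dynamics as long as the fluctuation
theorem of Eq. (3) holds." Rendered: for a probability measure `P`, a measurable involution `ι`
with `P ≪ ι_*P ≪ P`, `σ = llr P (ι_*P)` integrable and an `L²` observable `φ` odd under `ι`,
`(∫ φ dP)² ≤ ½ · Var[φ] · (exp(∫ σ dP) − 1)`. Grounds
`Summit.AtomisticToContinuum.FouriersLaw.Theses.BondHeatUncertainty.LinearResponseFTUR`.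
[cite: HasegawaVanVu2019, Eq. (10) (with Eqs. (1)–(3))] -/
def HasegawaVanVu2019_FTUR : Prop :=
  ∀ (Ω : Type) [MeasurableSpace Ω] (P : Measure Ω) [IsProbabilityMeasure P] (ι : Ω → Ω),
    Measurable ι → Function.Involutive ι → P ≪ P.map ι → P.map ι ≪ P →
    Integrable (llr P (P.map ι)) P →
    ∀ φ : Ω → ℝ, MemLp φ 2 P → (∀ ω, φ (ι ω) = -φ ω) →
      (∫ ω, φ ω ∂P) ^ 2 ≤
        (1 / 2) * variance φ P * (Real.exp (∫ ω, llr P (P.map ι) ω ∂P) - 1)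


/-! ## Proof of the FTUR (appended; D-0014 discharge `HasegawaVanVu2019_FTUR_holds`)

We follow the printed derivation, Hasegawa–Van Vu, PRL **123** (2019) 110602 = arXiv:1902.06376,
pp. 3–4, Eqs. (3)–(10), in the unfolded (two-sided) picture. Write `Q := ι_* P`,
`σ := llr P Q = log dP/dQ` and `E := e^{-σ} = dQ/dP` (`P`-a.e., Mathlib `exp_neg_llr`).

* Eq. (3) (joint detailed FT) in integrated form: `∫ E·g dP = ∫ g dQ = ∫ g∘ι dP` (`hFT`), and
  Eq. (1) `σ∘ι = -σ` a.e. (`hσodd`, from `MeasurableEmbedding.rnDeriv_map` and `neg_llr`).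
* The paper's folded density `Q(σ,φ) = (1+e^{-σ})P(σ,φ)` on `σ ≥ 0` is, unfolded, the weight
  `w := (1+E)/2` (a probability density w.r.t. `P`), and `tanh(σ/2) = t := (1-E)/(1+E)`.
  Eqs. (6)–(8): `⟨φ⟩ = ∫ w t φ dP`, `⟨σ⟩ = ∫ w t σ dP`, `⟨φ²⟩ = ∫ w φ² dP`, `∫ w dP = 1`.
* Eq. (9) (Cauchy–Schwarz): `⟨φ⟩² ≤ ⟨φ²⟩ · T`, `T := ∫ w t² dP`, via the discriminant of
  `x ↦ ∫ w (x t - φ)² dP ≥ 0` (`discrim_le_zero`).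
* Eq. (tanh-ineq) `T ≤ tanh(⟨σ⟩/2)`, proved without any `tanh` API in the equivalent form
  `log(1+T) - log(1-T) ≤ ⟨σ⟩`: the first half (the paper's `Δ(σ) ≥ 0`, i.e.
  `atanh(tanh²(σ/2)) ≤ (σ/2)tanh(σ/2)`) becomes the termwise comparison of Mercator series
  `t² - log(1-t²) ≤ t (log(1+t) - log(1-t)) = t σ` (`ftur_series_ineq`, a slight sharpening),
  and the Jensen step is replaced by the supporting-line inequality `log u ≤ u - 1` for the
  concave `log` (`ftur_pointwise_ineq`, integrated in `hlog`).
* Eq. (10): elementary algebra (`ftur_real_ineq`), in the division-free form of the `def`. -/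

/-- Termwise Mercator-series inequality: for `|t| < 1`,
`t² - log (1 - t²) ≤ t (log (1 + t) - log (1 - t))`; with `t = tanh (σ/2)` (so that the
right-hand side is `t σ`) this slightly sharpens the first half of the `tanh` inequality of
Hasegawa–Van Vu, `tanh²(σ/2) ≤ tanh((σ/2) tanh(σ/2))`, i.e. `log(1+t²) - log(1-t²) ≤ t σ` (their
`Δ(σ) ≥ 0`, p. 4), since `log (1 + t²) ≤ t²`; the sharpening absorbs the later use of
`log (1 + T) ≤ T`.
[cite: HasegawaVanVu2019, p. 4, first inequality of the display before Eq. (10)] -/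
theorem ftur_series_ineq {t : ℝ} (ht : |t| < 1) :
    t ^ 2 - Real.log (1 - t ^ 2) ≤ t * (Real.log (1 + t) - Real.log (1 - t)) := by
  have h1 := Real.hasSum_log_sub_log_of_abs_lt_one ht
  have ht2 : |t ^ 2| < 1 := by
    rw [abs_pow]
    exact pow_lt_one₀ (abs_nonneg t) ht two_ne_zero
  have h2 := Real.hasSum_pow_div_log_of_abs_lt_one ht2
  have h3 := (h1.mul_left t).sub h2
  have hterm : ∀ n : ℕ, t * (2 * (1 / (2 * (n : ℝ) + 1)) * t ^ (2 * n + 1))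
      - (t ^ 2) ^ (n + 1) / ((n : ℝ) + 1)
      = (t ^ 2) ^ (n + 1) / ((2 * (n : ℝ) + 1) * ((n : ℝ) + 1)) := by
    intro n
    have hn1 : (2 * (n : ℝ) + 1) ≠ 0 := by positivity
    have hn2 : ((n : ℝ) + 1) ≠ 0 := by positivity
    field_simp
    ring
  simp only [hterm] at h3
  have h4 := le_hasSum h3 0 (fun n _ => by positivity)
  norm_num at h4
  linarith

/-- Pointwise core of the `tanh` inequality of Hasegawa–Van Vu (both halves: `Δ(σ) ≥ 0` and the
Jensen step, the latter through the supporting line `log u ≤ u - 1` of the concave `log`), in the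
variables `E = e^{-σ}` and a constant `G > 0` (later `G = 1 - T`): with `w = (1+E)/2`,
`t = (1-E)/(1+E) = tanh(σ/2)` it reads `w (t² - log G) ≤ w (t σ + (1 - t²)/G - 1)`, obtained from
`ftur_series_ineq` and `log ((1-t²)/G) ≤ (1-t²)/G - 1`.
[cite: HasegawaVanVu2019, p. 4, display before Eq. (10)] -/
theorem ftur_pointwise_ineq (σ G : ℝ) (hG : 0 < G) :
    (1 - Real.exp (-σ)) ^ 2 / (2 * (1 + Real.exp (-σ)))
        - (1 + Real.exp (-σ)) / 2 * Real.log G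
      ≤ (σ - Real.exp (-σ) * σ) / 2 + 2 * Real.exp (-σ) / (1 + Real.exp (-σ)) / G
        - (1 + Real.exp (-σ)) / 2 := by
  set E := Real.exp (-σ) with hE
  have hEpos : 0 < E := Real.exp_pos _
  have h1E : 0 < 1 + E := by linarith
  have h1E' : 1 + E ≠ 0 := h1E.ne'
  have hlogE : Real.log E = -σ := by rw [hE, Real.log_exp]
  set t := (1 - E) / (1 + E) with ht
  have ht_abs : |t| < 1 := by
    rw [abs_lt, ht, lt_div_iff₀ h1E, div_lt_iff₀ h1E]
    constructor <;> linarith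
  have h1t : 1 + t = 2 / (1 + E) := by
    rw [ht]; field_simp; ring
  have h1t' : 1 - t = 2 * E / (1 + E) := by
    rw [ht]; field_simp; ring
  have h1t_pos : 0 < 1 + t := by rw [h1t]; positivity
  have h1t'_pos : 0 < 1 - t := by rw [h1t']; positivity
  have h1t2 : 1 - t ^ 2 = 4 * E / (1 + E) ^ 2 := by
    rw [ht]; field_simp; ring
  have h1t2_pos : 0 < 1 - t ^ 2 := by rw [h1t2]; positivity
  have hq : (1 + t) / (1 - t) = E⁻¹ := by
    rw [h1t, h1t']; field_simp
  have hlogt : Real.log (1 + t) - Real.log (1 - t) = σ := by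
    rw [← Real.log_div h1t_pos.ne' h1t'_pos.ne', hq, Real.log_inv, hlogE, neg_neg]
  have ha := ftur_series_ineq ht_abs
  rw [hlogt] at ha
  have hb : Real.log (1 - t ^ 2) - Real.log G ≤ (1 - t ^ 2) / G - 1 := by
    rw [← Real.log_div h1t2_pos.ne' hG.ne']
    exact Real.log_le_sub_one_of_pos (by positivity)
  have hc : t ^ 2 - Real.log G ≤ t * σ + (1 - t ^ 2) / G - 1 := by linarith
  have hd := mul_le_mul_of_nonneg_left hc (half_pos h1E).le
  have lhs_eq : (1 - E) ^ 2 / (2 * (1 + E)) - (1 + E) / 2 * Real.log G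
      = (1 + E) / 2 * (t ^ 2 - Real.log G) := by
    rw [ht]; field_simp
  have rhs_eq : (σ - E * σ) / 2 + 2 * E / (1 + E) / G - (1 + E) / 2
      = (1 + E) / 2 * (t * σ + (1 - t ^ 2) / G - 1) := by
    have hG' : G ≠ 0 := hG.ne'
    rw [ht]; field_simp; ring
  rw [lhs_eq, rhs_eq]
  exact hd

/-- The closing real-variable algebra of Hasegawa–Van Vu, Eqs. (9)–(10): from Cauchy–Schwarz
`m² ≤ T v`, `Var = v - m²`, and `log(1+T) - log(1-T) ≤ s` (here fed as `T - log (1-T) ≤ s`,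
using `log (1+T) ≤ T`), i.e. `T ≤ tanh(s/2)`, conclude `m² ≤ ½ · Var · (e^s - 1)`, the
division-free form of Eq. (10) `Var[φ]/⟨φ⟩² ≥ 2/(e^{⟨σ⟩} - 1)`.
[cite: HasegawaVanVu2019, Eq. (10)] -/
theorem ftur_real_ineq {m v T s V : ℝ} (hCS : m ^ 2 ≤ T * v) (hV : V = v - m ^ 2)
    (hV0 : 0 ≤ V) (hT0 : 0 ≤ T) (hT1 : T < 1) (hlog : T - Real.log (1 - T) ≤ s) :
    m ^ 2 ≤ 1 / 2 * V * (Real.exp s - 1) := by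
  have hG : 0 < 1 - T := by linarith
  have h1 : Real.log (1 + T) ≤ T := by
    have := Real.log_le_sub_one_of_pos (show (0 : ℝ) < 1 + T by linarith)
    linarith
  have h2 : Real.log ((1 + T) / (1 - T)) ≤ s := by
    rw [Real.log_div (by linarith : (1 + T) ≠ 0) hG.ne']
    linarith
  have h3 : (1 + T) / (1 - T) ≤ Real.exp s := by
    rwa [Real.log_le_iff_le_exp (div_pos (by linarith) hG)] at h2
  have h4 : 1 + T ≤ Real.exp s * (1 - T) := by rwa [div_le_iff₀ hG] at h3
  have hv : v = V + m ^ 2 := by linarith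
  rw [hv] at hCS
  have h5 : m ^ 2 * (1 - T) ≤ T * V := by linarith
  have hE1 : 0 ≤ Real.exp s + 1 := by positivity
  nlinarith [mul_le_mul_of_nonneg_left h4 (sq_nonneg m), mul_le_mul_of_nonneg_left h5 hE1,
    mul_le_mul_of_nonneg_left h4 hV0]

/-- **Discharge of `HasegawaVanVu2019_FTUR`** (Hasegawa–Van Vu, PRL 123 (2019) 110602, Eq. (10)),
following the printed proof (pp. 3–4 of arXiv:1902.06376): integrated detailed fluctuation theorem,
the three moment identities under the symmetrised weight, Cauchy–Schwarz, and the `tanh`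
inequality (here in logarithmic form). [cite: HasegawaVanVu2019, Eqs. (3), (6)–(10)] -/
theorem HasegawaVanVu2019_FTUR_holds : HasegawaVanVu2019_FTUR := by
  intro Ω _ P _ ι hι hinv hPQ hQP hσ φ hφ hodd
  -- `ι` as a measurable equivalence, `Q := ι_* P`, `ι_* Q = P`
  let e : Ω ≃ᵐ Ω :=
    { toFun := ι, invFun := ι, left_inv := hinv.leftInverse, right_inv := hinv.rightInverse,
      measurable_toFun := hι, measurable_invFun := hι }
  set Q : Measure Ω := P.map ι with hQ
  haveI : IsProbabilityMeasure Q := Measure.isProbabilityMeasure_map hι.aemeasurable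
  have hQmap : Q.map ι = P := by
    rw [hQ, Measure.map_map hι hι, hinv.comp_self, Measure.map_id]
  -- change of variables under `ι`
  have hcov : ∀ g : Ω → ℝ, ∫ ω, g ω ∂Q = ∫ ω, g (ι ω) ∂P := fun g => integral_map_equiv e g
  have hcov_int : ∀ g : Ω → ℝ, Integrable (fun ω => g (ι ω)) P → Integrable g Q :=
    fun g hg => (integrable_map_equiv e g).mpr hg
  -- `σ = log dP/dQ` and the density `E = e^{-σ} = dQ/dP`
  set σ : Ω → ℝ := llr P Q with hσdef
  have hσmeas : Measurable σ := measurable_llr _ _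
  set E : Ω → ℝ := fun ω => Real.exp (-σ ω) with hEdef
  have hEmeas : Measurable E := hσmeas.neg.exp
  have hEpos : ∀ ω, 0 < E ω := fun ω => Real.exp_pos _
  have h1E : ∀ ω, 0 < 1 + E ω := fun ω => by linarith [hEpos ω]
  have hE_ae : E =ᵐ[P] fun ω => (Q.rnDeriv P ω).toReal := exp_neg_llr hPQ
  have hEint : Integrable E P := Measure.integrable_toReal_rnDeriv.congr hE_ae.symm
  -- Eq. (3), integrated: `∫ E g dP = ∫ g dQ = ∫ g ∘ ι dP`
  have hFT_int : ∀ g : Ω → ℝ, Integrable (fun ω => g (ι ω)) P →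
      Integrable (fun ω => E ω * g ω) P := by
    intro g hg
    have h1 : Integrable (fun ω => (Q.rnDeriv P ω).toReal * g ω) P :=
      (integrable_toReal_rnDeriv_mul_iff hQP).mpr (hcov_int g hg)
    refine h1.congr ?_
    filter_upwards [hE_ae] with ω hω
    rw [hω]
  have hFT : ∀ g : Ω → ℝ, ∫ ω, E ω * g ω ∂P = ∫ ω, g (ι ω) ∂P := by
    intro g
    calc ∫ ω, E ω * g ω ∂P = ∫ ω, (Q.rnDeriv P ω).toReal * g ω ∂P := by
          refine integral_congr_ae ?_
          filter_upwards [hE_ae] with ω hω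
          rw [hω]
      _ = ∫ ω, g ω ∂Q := integral_toReal_rnDeriv_mul hQP
      _ = ∫ ω, g (ι ω) ∂P := hcov g
  -- Eq. (1): `σ ∘ ι = -σ` almost everywhere
  have hσodd : (fun ω => σ (ι ω)) =ᵐ[P] fun ω => -σ ω := by
    have h1 : (fun x => (Q.map ι).rnDeriv Q (ι x)) =ᵐ[P] Q.rnDeriv P :=
      e.measurableEmbedding.rnDeriv_map Q P
    rw [hQmap] at h1
    have h2 : -llr P Q =ᵐ[P] llr Q P := neg_llr hPQ
    filter_upwards [h1, h2] with ω h1ω h2ω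
    have h3 : llr Q P ω = -llr P Q ω := by rw [← h2ω, Pi.neg_apply]
    calc σ (ι ω) = Real.log (P.rnDeriv Q (ι ω)).toReal := rfl
      _ = Real.log (Q.rnDeriv P ω).toReal := by rw [h1ω]
      _ = llr Q P ω := rfl
      _ = -σ ω := h3
  -- integrability bookkeeping
  have hφint : Integrable φ P := hφ.integrable one_le_two
  have hφ2int : Integrable (fun ω => φ ω ^ 2) P := hφ.integrable_sq
  have hφι : (fun ω => φ (ι ω)) = fun ω => -φ ω := funext hodd
  have hEφint : Integrable (fun ω => E ω * φ ω) P :=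
    hFT_int φ (by rw [hφι]; exact hφint.neg)
  have hEφ2int : Integrable (fun ω => E ω * φ ω ^ 2) P :=
    hFT_int (fun ω => φ ω ^ 2) (by simp only [hodd, neg_sq]; exact hφ2int)
  have hEσint : Integrable (fun ω => E ω * σ ω) P := hFT_int σ (hσ.neg.congr hσodd.symm)
  -- the moments, Eqs. (6)–(8)
  set m : ℝ := ∫ ω, φ ω ∂P with hm
  set v : ℝ := ∫ ω, φ ω ^ 2 ∂P with hv
  set s : ℝ := ∫ ω, σ ω ∂P with hs
  have hEφ : ∫ ω, E ω * φ ω ∂P = -m := by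
    rw [hFT φ, hφι, integral_neg]
  have hEφ2 : ∫ ω, E ω * φ ω ^ 2 ∂P = v := by
    have h := hFT (fun ω => φ ω ^ 2)
    simp only [hodd, neg_sq] at h
    exact h
  have hEσ : ∫ ω, E ω * σ ω ∂P = -s := by
    rw [hFT σ, integral_congr_ae hσodd, integral_neg]
  have hE1 : ∫ ω, E ω ∂P = 1 := by simpa using hFT (fun _ => (1 : ℝ))
  -- the weights `w = (1+E)/2`, `w t² = (1-E)²/(2(1+E))`, `w (1-t²) = 2E/(1+E)`
  have hA4nn : ∀ ω, 0 ≤ (1 - E ω) ^ 2 / (2 * (1 + E ω)) := fun ω => by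
    have := h1E ω; positivity
  have hA5int : Integrable (fun ω => (1 + E ω) / 2) P :=
    ((integrable_const (1 : ℝ)).add hEint).div_const 2
  have hA4int : Integrable (fun ω => (1 - E ω) ^ 2 / (2 * (1 + E ω))) P := by
    refine hA5int.mono' ?_ (Filter.Eventually.of_forall fun ω => ?_)
    · exact (by fun_prop : Measurable fun ω => (1 - E ω) ^ 2 / (2 * (1 + E ω))).aestronglyMeasurable
    · rw [Real.norm_eq_abs, abs_of_nonneg (hA4nn ω), div_le_iff₀ (by have := h1E ω; positivity)]
      nlinarith [hEpos ω]
  set T : ℝ := ∫ ω, (1 - E ω) ^ 2 / (2 * (1 + E ω)) ∂P with hT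
  have hT0 : 0 ≤ T := integral_nonneg hA4nn
  have hA5 : ∫ ω, (1 + E ω) / 2 ∂P = 1 := by
    rw [integral_div, integral_add (integrable_const _) hEint, hE1]
    norm_num
  have hA6int : Integrable (fun ω => 2 * E ω / (1 + E ω)) P := by
    refine (integrable_const (2 : ℝ)).mono' ?_ (Filter.Eventually.of_forall fun ω => ?_)
    · exact (by fun_prop : Measurable fun ω => 2 * E ω / (1 + E ω)).aestronglyMeasurable
    · have := hEpos ω
      rw [Real.norm_eq_abs, abs_of_nonneg (by positivity), div_le_iff₀ (h1E ω)]
      linarith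
  have hA6 : ∫ ω, 2 * E ω / (1 + E ω) ∂P = 1 - T := by
    have heq : (fun ω => 2 * E ω / (1 + E ω))
        = fun ω => (1 + E ω) / 2 - (1 - E ω) ^ 2 / (2 * (1 + E ω)) := by
      funext ω
      have := (h1E ω).ne'
      field_simp
      ring
    rw [heq, integral_sub hA5int hA4int, hA5, ← hT]
  have hT1 : T < 1 := by
    have hpos : 0 < ∫ ω, 2 * E ω / (1 + E ω) ∂P := by
      have hnn : ∀ ω, 0 ≤ 2 * E ω / (1 + E ω) := fun ω => by
        have := hEpos ω; have := h1E ω; positivity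
      rw [integral_pos_iff_support_of_nonneg hnn hA6int]
      have hsupp : Function.support (fun ω => 2 * E ω / (1 + E ω)) = Set.univ :=
        Set.eq_univ_of_forall fun ω => by
          rw [Function.mem_support]
          have := hEpos ω; have := h1E ω
          positivity
      rw [hsupp, measure_univ]
      exact zero_lt_one
    linarith
  -- Eq. (9): Cauchy–Schwarz `m² ≤ T v` through the discriminant of `x ↦ ∫ w (x t - φ)² dP ≥ 0`
  have hquad : ∀ x : ℝ, 0 ≤ T * (x * x) + (-2 * m) * x + v := by
    intro x
    have hI1 : Integrable (fun ω => φ ω - E ω * φ ω) P := hφint.sub hEφint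
    have hI2 : Integrable (fun ω => (φ ω ^ 2 + E ω * φ ω ^ 2) / 2) P :=
      (hφ2int.add hEφ2int).div_const 2
    have hIa1 : Integrable (fun ω => x ^ 2 * ((1 - E ω) ^ 2 / (2 * (1 + E ω)))) P :=
      hA4int.const_mul _
    have hIa2 : Integrable (fun ω => x * (φ ω - E ω * φ ω)) P := hI1.const_mul _
    have hIa : Integrable (fun ω => x ^ 2 * ((1 - E ω) ^ 2 / (2 * (1 + E ω)))
        - x * (φ ω - E ω * φ ω)) P := hIa1.sub hIa2
    have hexp : ∫ ω, (x ^ 2 * ((1 - E ω) ^ 2 / (2 * (1 + E ω))) - x * (φ ω - E ω * φ ω)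
        + (φ ω ^ 2 + E ω * φ ω ^ 2) / 2) ∂P = T * (x * x) + (-2 * m) * x + v := by
      rw [integral_add hIa hI2, integral_sub hIa1 hIa2, integral_const_mul, integral_const_mul,
        integral_div, integral_sub hφint hEφint, integral_add hφ2int hEφ2int, hEφ, hEφ2,
        ← hT, ← hm]
      ring
    have hnn : ∀ ω, 0 ≤ x ^ 2 * ((1 - E ω) ^ 2 / (2 * (1 + E ω))) - x * (φ ω - E ω * φ ω)
        + (φ ω ^ 2 + E ω * φ ω ^ 2) / 2 := fun ω => by
      have hω := h1E ω
      have heq : x ^ 2 * ((1 - E ω) ^ 2 / (2 * (1 + E ω))) - x * (φ ω - E ω * φ ω)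
          + (φ ω ^ 2 + E ω * φ ω ^ 2) / 2
          = (x * (1 - E ω) - (1 + E ω) * φ ω) ^ 2 / (2 * (1 + E ω)) := by
        field_simp
        ring
      rw [heq]
      positivity
    rw [← hexp]
    exact integral_nonneg hnn
  have hCS : m ^ 2 ≤ T * v := by
    have hd := discrim_le_zero hquad
    rw [discrim] at hd
    nlinarith [hd]
  have hVar : variance φ P = v - m ^ 2 := by
    simp only [variance_eq_sub hφ, Pi.pow_apply, hv, hm]
  -- Eq. (tanh-ineq): `T ≤ tanh (s/2)`, in the logarithmic form `T - log (1 - T) ≤ s`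
  have hlog : T - Real.log (1 - T) ≤ s := by
    have hGpos : 0 < 1 - T := by linarith
    have hLint : Integrable (fun ω => (1 - E ω) ^ 2 / (2 * (1 + E ω))
        - (1 + E ω) / 2 * Real.log (1 - T)) P := hA4int.sub (hA5int.mul_const _)
    have hI3 : Integrable (fun ω => σ ω - E ω * σ ω) P := hσ.sub hEσint
    have hI3' : Integrable (fun ω => (σ ω - E ω * σ ω) / 2) P := hI3.div_const _
    have hI4 : Integrable (fun ω => 2 * E ω / (1 + E ω) / (1 - T)) P := hA6int.div_const _
    have hI34 : Integrable (fun ω => (σ ω - E ω * σ ω) / 2 + 2 * E ω / (1 + E ω) / (1 - T)) P :=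
      hI3'.add hI4
    have hRint : Integrable (fun ω => (σ ω - E ω * σ ω) / 2 + 2 * E ω / (1 + E ω) / (1 - T)
        - (1 + E ω) / 2) P := hI34.sub hA5int
    have hmono := integral_mono hLint hRint (fun ω => ftur_pointwise_ineq (σ ω) (1 - T) hGpos)
    have hL : ∫ ω, ((1 - E ω) ^ 2 / (2 * (1 + E ω))
        - (1 + E ω) / 2 * Real.log (1 - T)) ∂P = T - Real.log (1 - T) := by
      rw [integral_sub hA4int (hA5int.mul_const _), integral_mul_const, hA5, ← hT]
      ring
    have hR1 : ∫ ω, (σ ω - E ω * σ ω) / 2 ∂P = s := by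
      rw [integral_div, integral_sub hσ hEσint, hEσ, ← hs]
      ring
    have hR2 : ∫ ω, 2 * E ω / (1 + E ω) / (1 - T) ∂P = 1 := by
      rw [integral_div, hA6, div_self hGpos.ne']
    have hR : ∫ ω, ((σ ω - E ω * σ ω) / 2 + 2 * E ω / (1 + E ω) / (1 - T)
        - (1 + E ω) / 2) ∂P = s := by
      rw [integral_sub hI34 hA5int, integral_add hI3' hI4, hR1, hR2, hA5]
      ring
    linarith [hmono, hL, hR]
  -- Eq. (10)
  exact ftur_real_ineq hCS hVar (variance_nonneg φ P) hT0 hT1 hlog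

end Literature.Probability.Entropy
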